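import Mathlib
import Summits.NavierStokesRegularity.NavierStokesRegularity.Theses.ExactWindowRungThree
import HarnessLib

/-!
# `ExactWindowRungThree.SegmentMeanValue` — the one-variable mean value inequality on `[0,1]`
(item stmt-NavierStokesRegularity-23174; provable-now, S)

**Statement.** If `f` has derivative `ψ σ` within `[0,1]` at every `σ ∈ [0,1]` and `|ψ σ| ≤ b`
there, then `|f 1 − f 0| ≤ b`.

PROOF. Mathlib's `Convex.norm_image_sub_le_of_norm_hasDerivWithin_le` on the convex set `[0,1]`
with `x = 0`, `y = 1`.

HONEST FRAMING: elementary calculus; nothing here bears on Navier–Stokes regularity.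
-/

noncomputable section

set_option linter.dupNamespace false

namespace Summit.NavierStokesRegularity.NavierStokesRegularity.Theorems

/-- **Item stmt-NavierStokesRegularity-23174** (`ExactWindowRungThree.SegmentMeanValue`): the mean
value inequality `|f 1 − f 0| ≤ b` for a function with derivative bounded by `b` within `[0,1]`.
[this file] -/
theorem exactWindowRungThree_segmentMeanValue_proof :
    Summit.NavierStokesRegularity.NavierStokesRegularity.Theses.ExactWindowRungThree.SegmentMeanValue := by
  unfold Summit.NavierStokesRegularity.NavierStokesRegularity.Theses.ExactWindowRungThree.SegmentMeanValue
  intro f ψ b h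
  have key := (convex_Icc (0 : ℝ) 1).norm_image_sub_le_of_norm_hasDerivWithin_le
    (f := f) (f' := ψ) (C := b) (fun σ hσ => (h σ hσ).1)
    (fun σ hσ => by simpa [Real.norm_eq_abs] using (h σ hσ).2)
    (Set.left_mem_Icc.2 zero_le_one) (Set.right_mem_Icc.2 zero_le_one)
  simpa [Real.norm_eq_abs] using key

end Summit.NavierStokesRegularity.NavierStokesRegularity.Theorems

end
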